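import Literature.MathematicalPhysics.QuantumFieldTheory.Balaban1983to89.B5Hk160Torus

/-!
# `Balaban1983to89.B5Eq172Torus` — T. Bałaban, *Propagators and renormalization transformations for
# lattice gauge theories. I*, Commun. Math. Phys. **95** (1984) 17–40 [Balaban1984PropagatorsI]:
# the PRINTED p. 30 proof that `Δ_a` is a positive (hence invertible) operator — (1.72) and the
# zero-mode argument «A = ∂Δ⁻²Q′*(Q′Δ⁻²Q′*)⁻¹ω + A₀ … QA = ∂₁ω + A₀ = 0, hence ∂₁*∂₁ω = 0 … ω = 0 …
# A₀ = 0, so A = 0» — for the torus matrices of record (`B5DeltaA169.DeltaA`)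

statement-level skeleton of published theorems with citation tags; proofs where landed; nothing here is a claim about the Yang–Mills mass gap

PDF held: `paper:balaban1984-cmp95-propagators-rt-i` (journal page = PDF page + 16); p. 30 read this session
from the page render `1984-cmp95-propagators-rt-I-p014-x4.png` (not from OCR).

WHAT IS REPRODUCED.  SKELETON row **B5.Eq1.72** of `run/shared/lean/pub/lit-balaban/SKELETON.md` («Δ_a is
a positive operator»: (1.72) + its proof, p. 30).  Status before this file (ROWS-B5): «proved-torus via the
fiber decomposition, NOT the printed kernel argument» (decl of record `B5DeltaA169.DeltaA_posDef`, through the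
(1.83) fibres), the printed zero-mode step proved on the V1 calculus (`B5Positivity172Lattice`, p11).  HERE: the
printed kernel argument itself, line by line, on the SAME carrier as `DeltaA` (vector functions on the torus
`T_η = Tor (fine n M)`), including the torus Poincaré lemma it uses («From the first equation we get
A = ∂(…) + A₀»).  Third file of Phase-2 seat **p37** (gen 4) of `PHASE2-TARGETS.md` §G (cell `lit-balaban`,
unit `lit-balaban-p37`, HOME `run/shared/lean/pub/lit-balaban/`).  This file declares NO `def`: theorems only.

## The printed text (p. 30; verbatim)

«At first let us prove that Δ_a is a positive operator. Of course it is a symmetric operator and it is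
non-negative as a sum of two non-negative operators Δ − ∂P∂* and aQ*Q, a > 0. Thus if for some A we have
Δ_aA = 0, then
  ΔA − ∂P∂*A = 0, QA = 0.   (1.72)
From the first equation we get A = ∂Δ⁻²Q′*(Q′Δ⁻²Q′*)⁻¹ω + A₀, where A₀ is a constant vector function and
ω is a function on unit lattice T₁^{(k)} orthogonal to constant functions. Using (1.55) we have
  QA = ∂₁Q′Δ⁻²Q′*(Q′Δ⁻²Q′*)⁻¹ω + A₀ = ∂₁ω + A₀ = 0,
hence ∂₁*∂₁ω = 0, and this implies ω = 0. The above equation implies A₀ = 0, so A = 0 and the positivity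
of Δ_a follows. It is an invertible operator and the equation
  ΔA − ∂Δ⁻¹Q′*(Q′Δ⁻²Q′*)⁻¹Q′Δ⁻¹∂*A + aQ*QA = J   (1.73)
has a unique solution for the arbitrary vector function J.»

## Dictionary (the tree's typed torus operators; `T_η = Tor (fine n M)`, unit lattice `T₁^{(k)} = Tor M`,
`n = L^k`, any `d`, `n ≥ 1`, `M_μ ≥ 1`, `a > 0`)

`Δ_a = B5DeltaA169.DeltaA` ((1.69)/(1.73)), `Δ = B5Prop11Lower.Lap` (componentwise), `∂ = GradOp (fine n M) n`,
`∂* = ∂ᴴ`, the field strength `F_{μν} = B5Action121.Fs` ((1.2); «∂A» of (1.21)), `P = B5Value126.PcT` ((1.70)),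
`R∂*A = B5Hk164Transl.RdivS A = (1 − P)∂*A`, `Q = QvOp`, `Q* = QvAdj = n^d•Qᴴ`, `Q′ = QsOp`,
`Q′* = B5Hk160Torus.QsAdj`, `(Q′Δ⁻²Q′*)⁻¹ = Einv` (on `1^⊥`), scalar `Δ⁻¹ = LapSinv`, `∂₁ = GradOp M 1`,
`Δ₀ = ∂₁*∂₁ = LapS M 1`; the printed `ω` IS `Q′Δ⁻¹∂*A` and the printed `A₀` IS the componentwise mean
`B5Hk160Torus.B0 (fine n M) A` (on `T₁^{(k)}`: the constant configuration `constV M c` with the same components).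

## What is certified (kernel, zero `sorry`, axioms ⊆ {propext, Classical.choice, Quot.sound})

* §1 **(1.72)** `eq172`: `Δ_aA = 0 ⇒ ΔA − ∂P∂*A = 0 ∧ QA = 0` — from the (1.69) decomposition
  `Re⟨A, Δ_aA⟩ = ½Σ|F_{μν}|² + ‖R∂*A‖² + a·n^d‖QA‖²` («non-negative as a sum of … non-negative operators»,
  the landed `B5Hk164Transl.re_form_DeltaA`); with the two further printed consequences `∂A = 0` (all
  `F_{μν} = 0`) and `R∂*A = 0` (`consequences_of_DeltaA_eq_zero`).
* §2 the torus Poincaré lemma behind «From the first equation we get»: on ANY discrete torus, a curl-free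
  vector function is a gradient plus a constant, explicitly `A = ∂Δ⁻¹∂*A + A₀` (`eq_grad_add_const_of_Fs_eq_zero`;
  Fourier side: `F̂_{μν} = ∂_μ(p)Â_ν − ∂_ν(p)Â_μ = 0` forces `Â(p) ∥ ∂(p)` off the zero mode).
* §3 the printed chain: «A = ∂Δ⁻²Q′*(Q′Δ⁻²Q′*)⁻¹ω + A₀ … ω ⊥ 1» (`eq_of_first_equation`, `sum_omega`),
  «Using (1.55) QA = ∂₁ω + A₀» (`QvOp_first_equation`), «hence ∂₁*∂₁ω = 0» (`LapS_omega_eq_zero`), and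
  **«ω = 0 … A₀ = 0, so A = 0»: `eq_zero_of_DeltaA_mulVec_eq_zero`** (`a > 0`).
* §4 «It is an invertible operator and the equation (1.73) has a unique solution»: `DeltaA_mulVec_injective`,
  and — as kernel-checked `example`s obtained from it — `IsUnit (DeltaA n M a)` and `∃! A, Δ_aA = J` (the
  decls of record stay `B5DeltaA169.isUnit_DeltaA` / `existsUnique_solution` / `DeltaA_posDef`, fibre route;
  not re-declared).

HONEST SCOPE.  Finite torus (periods `n·M_μ`), complex fields; «it is a symmetric operator» and the
non-negativity of the two summands are the landed `B5DeltaA169.DeltaA_isHermitian` / `B5Hk164Transl.re_form_DeltaA`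
(not re-proved); positivity is certified here as «Δ_aA = 0 ⇒ A = 0» + invertibility, the Löwner statement
`DeltaA_posDef` staying with `B5DeltaA169`.  NOT summit progress.
-/

open scoped BigOperators Matrix ComplexConjugate
open Finset Complex

namespace Literature.MathematicalPhysics.QuantumFieldTheory.Balaban1983to89.B5Eq172Torus

open Literature.MathematicalPhysics.QuantumFieldTheory.Balaban1983to89
open Literature.MathematicalPhysics.QuantumFieldTheory.Balaban1983to89.B5Prop11Plancherel (Tor dft fine)
open Literature.MathematicalPhysics.QuantumFieldTheory.Balaban1983to89.B5Prop11Lower (Lap)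
open Literature.MathematicalPhysics.QuantumFieldTheory.Balaban1983to89.B5Action121 (comp LapS GradOp sdiff pd
  Fs GradOp_mulVec)
open Literature.MathematicalPhysics.QuantumFieldTheory.Balaban1983to89.B5Block118 (QsOp QvOp cT)
open Literature.MathematicalPhysics.QuantumFieldTheory.Balaban1983to89.B5LaplaceInverse (ssym lsym LapSinv
  dft_mul_sdiff LapSinv_LapS_of_orth)
open Literature.MathematicalPhysics.QuantumFieldTheory.Balaban1983to89.B5Momentum130 (dft_zero_apply
  lsym_eq_zero_iff)
open Literature.MathematicalPhysics.QuantumFieldTheory.Balaban1983to89.B5Momentum133 (dft_LapSinv_apply)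
open Literature.MathematicalPhysics.QuantumFieldTheory.Balaban1983to89.B5DeltaA169 (QvAdj DeltaA DeltaA_mulVec
  dft_comp_GradOp dft_GradOp_adjoint)
open Literature.MathematicalPhysics.QuantumFieldTheory.Balaban1983to89.B5Value126 (PcT PcT_mulVec
  sum_QsOp_LapSinv)
open Literature.MathematicalPhysics.QuantumFieldTheory.Balaban1983to89.B5Phi162Torus (eq_of_comp_eq OrthConst
  dft_const_of_ne)
open Literature.MathematicalPhysics.QuantumFieldTheory.Balaban1983to89.B5Hk160Torus (ssym_zero
  divS_GradOp_mulVec constV divS_constV QvOp_constV B0 QvOp_GradOp_mulVec QsAdj Einv QsAdj_Einv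
  QsOp_LapSinv2_QsAdj_Einv)
open Literature.MathematicalPhysics.QuantumFieldTheory.Balaban1983to89.B5Hk163Torus (dft_mulVec_injective)
open Literature.MathematicalPhysics.QuantumFieldTheory.Balaban1983to89.B5Hk164Transl (cEnergy cEnergy_eq
  cEnergy_nonneg RdivS re_form_DeltaA)

noncomputable section

variable {d : ℕ}

/-! ## §2 (placed first: no `Δ_a` needed) The torus Poincaré lemma: curl-free ⇒ gradient + constant -/

section Poincare

variable (N : Fin d → ℕ) [hN : ∀ ν, NeZero (N ν)]

/-- the symbol of the field strength: `F̂_{μν}(p) = ∂_μ(p)Â_ν(p) − ∂_ν(p)Â_μ(p)` ((1.2) and the symbol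
`∂_μ(p)` of (1.31)). [cite: Balaban1984PropagatorsI, (1.2) p.18, (1.31) p.23] -/
theorem dft_Fs (c : ℂ) (A : Tor N × Fin d → ℂ) (μ ν : Fin d) (p : Tor N) :
    (dft N *ᵥ Fs N c A μ ν) p
      = ssym N c μ p * (dft N *ᵥ comp N A ν) p - ssym N c ν p * (dft N *ᵥ comp N A μ) p := by
  have hFs : Fs N c A μ ν = sdiff N c μ *ᵥ comp N A ν - sdiff N c ν *ᵥ comp N A μ := rfl
  have hsd : ∀ (κ : Fin d) (f : Tor N → ℂ), (dft N *ᵥ (sdiff N c κ *ᵥ f)) p = ssym N c κ p * (dft N *ᵥ f) p :=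
    fun κ f => by
      rw [Matrix.mulVec_mulVec, dft_mul_sdiff, ← Matrix.mulVec_mulVec, Matrix.mulVec_diagonal]
  rw [hFs, Matrix.mulVec_sub, Pi.sub_apply, hsd, hsd]

/-- **the torus Poincaré lemma** («From the first equation we get A = ∂(…) + A₀, where A₀ is a constant
vector function»): on the discrete torus a vector function with vanishing field strength `F_{μν} ≡ 0` («∂A = 0»)
is a gradient plus a constant, explicitly `A = ∂(Δ⁻¹∂*A) + A₀` with `A₀` the componentwise mean of `A`
(lattice constant `c ≠ 0`; `Δ⁻¹` the tree's inverse on `1^⊥`). [cite: Balaban1984PropagatorsI, p.30 after (1.72)] -/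
theorem eq_grad_add_const_of_Fs_eq_zero {c : ℂ} (hc : c ≠ 0) {A : Tor N × Fin d → ℂ}
    (hF : ∀ μ ν x, Fs N c A μ ν x = 0) :
    A = GradOp N c *ᵥ (LapSinv N c *ᵥ ((GradOp N c)ᴴ *ᵥ A)) + B0 N A := by
  have hT : (Fintype.card (Tor N) : ℂ) ≠ 0 := Nat.cast_ne_zero.mpr Fintype.card_ne_zero
  -- curl-free in momentum space: `∂_μ(p)Â_ν(p) = ∂_ν(p)Â_μ(p)`
  have hcurl : ∀ (μ ν : Fin d) (p : Tor N),
      ssym N c μ p * (dft N *ᵥ comp N A ν) p = ssym N c ν p * (dft N *ᵥ comp N A μ) p := by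
    intro μ ν p
    have h0 : Fs N c A μ ν = 0 := funext fun x => hF μ ν x
    have h := dft_Fs N c A μ ν p
    rw [h0, Matrix.mulVec_zero, Pi.zero_apply] at h
    exact (sub_eq_zero.mp h.symm)
  refine eq_of_comp_eq N fun κ => dft_mulVec_injective N ?_
  funext p
  have hadd : comp N (GradOp N c *ᵥ (LapSinv N c *ᵥ ((GradOp N c)ᴴ *ᵥ A)) + B0 N A) κ
      = comp N (GradOp N c *ᵥ (LapSinv N c *ᵥ ((GradOp N c)ᴴ *ᵥ A))) κ + comp N (B0 N A) κ := rfl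
  have hB0 : comp N (B0 N A) κ = fun _ => ((Fintype.card (Tor N) : ℂ))⁻¹ * ∑ y, A (y, κ) := rfl
  show (dft N *ᵥ comp N A κ) p
    = (dft N *ᵥ comp N (GradOp N c *ᵥ (LapSinv N c *ᵥ ((GradOp N c)ᴴ *ᵥ A)) + B0 N A) κ) p
  rw [hadd, Matrix.mulVec_add, Pi.add_apply, dft_comp_GradOp, dft_LapSinv_apply, dft_GradOp_adjoint, hB0]
  by_cases hp : p = 0
  · -- the zero mode: only the constant `A₀` contributes, with the right value
    subst hp
    rw [ssym_zero, zero_mul, zero_add, dft_zero_apply, dft_zero_apply, Finset.sum_const, Finset.card_univ,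
      nsmul_eq_mul, ← mul_assoc (Fintype.card (Tor N) : ℂ), mul_inv_cancel₀ hT, one_mul]
    rfl
  · -- off the zero mode: `∂_κ(p)Δ(p)⁻¹Σ_ν conj(∂_ν(p))Â_ν(p) = Â_κ(p)` by the curl-free relation
    have hl : lsym N c p ≠ 0 := fun h => hp ((lsym_eq_zero_iff N hc p).mp h)
    rw [dft_const_of_ne N _ hp, add_zero]
    have key : (∑ ν, conj (ssym N c ν p) * (dft N *ᵥ comp N A ν) p) * ssym N c κ p
        = lsym N c p * (dft N *ᵥ comp N A κ) p := by
      rw [lsym, Finset.sum_mul, Finset.sum_mul]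
      refine Finset.sum_congr rfl fun ν _ => ?_
      rw [mul_assoc, mul_comm ((dft N *ᵥ comp N A ν) p) (ssym N c κ p), hcurl κ ν p]
      ring
    calc (dft N *ᵥ comp N A κ) p
        = (lsym N c p)⁻¹ * (lsym N c p * (dft N *ᵥ comp N A κ) p) := by
          rw [← mul_assoc, inv_mul_cancel₀ hl, one_mul]
      _ = ssym N c κ p * ((lsym N c p)⁻¹ * ∑ ν, conj (ssym N c ν p) * (dft N *ᵥ comp N A ν) p) := by
          rw [← key]; ring

end Poincare

section Main

variable (n : ℕ) [NeZero n] (M : Fin d → ℕ) [hM : ∀ μ, NeZero (M μ)] (a : ℝ)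

/-! ## §1 (1.72) -/

/-- the three printed consequences of `Δ_aA = 0` (`a > 0`): `∂A = 0` (all `F_{μν}[A] = 0`), `R∂*A = 0`, and
`QA = 0` — since `Re⟨A, Δ_aA⟩ = ½Σ|F_{μν}|² + ‖R∂*A‖² + a·n^d‖QA‖²` is «a sum of … non-negative» terms
(`B5Hk164Transl.re_form_DeltaA`, (1.69)). [cite: Balaban1984PropagatorsI, (1.72) p.30, (1.69) p.29] -/
theorem consequences_of_DeltaA_eq_zero (ha : 0 < a) {A : Tor (fine n M) × Fin d → ℂ}
    (hA : DeltaA n M a *ᵥ A = 0) :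
    (∀ μ ν x, Fs (fine n M) (n : ℂ) A μ ν x = 0) ∧ RdivS n M A = 0 ∧ QvOp n M *ᵥ A = 0 := by
  have h := re_form_DeltaA n M a A
  rw [hA, dotProduct_zero, Complex.zero_re, cEnergy_eq] at h
  have h1 : 0 ≤ (1 / 2 : ℝ) * ∑ x, ∑ μ, ∑ ν, ‖Fs (fine n M) (n : ℂ) A μ ν x‖ ^ 2 := by positivity
  have h2 : 0 ≤ ∑ x, ‖RdivS n M A x‖ ^ 2 := by positivity
  have h3 : 0 ≤ a * (n : ℝ) ^ d * ∑ y, ‖(QvOp n M *ᵥ A) y‖ ^ 2 := by positivity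
  have hnd : 0 < a * (n : ℝ) ^ d := by
    have : (0 : ℝ) < n := by exact_mod_cast Nat.pos_of_ne_zero (NeZero.ne n)
    positivity
  have e1 : ∑ x, ∑ μ, ∑ ν, ‖Fs (fine n M) (n : ℂ) A μ ν x‖ ^ 2 = 0 := by linarith
  have e2 : ∑ x, ‖RdivS n M A x‖ ^ 2 = 0 := by linarith
  have e3 : ∑ y, ‖(QvOp n M *ᵥ A) y‖ ^ 2 = 0 := by
    have : a * (n : ℝ) ^ d * ∑ y, ‖(QvOp n M *ᵥ A) y‖ ^ 2 = 0 := by linarith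
    rcases mul_eq_zero.mp this with h0 | h0
    · exact absurd h0 hnd.ne'
    · exact h0
  refine ⟨fun μ ν x => ?_, funext fun x => ?_, funext fun y => ?_⟩
  · have hx := (Finset.sum_eq_zero_iff_of_nonneg fun x _ => by positivity).mp e1 x (Finset.mem_univ x)
    have hμ := (Finset.sum_eq_zero_iff_of_nonneg fun μ _ => by positivity).mp hx μ (Finset.mem_univ μ)
    have hν := (Finset.sum_eq_zero_iff_of_nonneg fun ν _ => by positivity).mp hμ ν (Finset.mem_univ ν)
    exact norm_eq_zero.mp ((pow_eq_zero_iff two_ne_zero).mp hν)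
  · have hx := (Finset.sum_eq_zero_iff_of_nonneg fun x _ => by positivity).mp e2 x (Finset.mem_univ x)
    exact norm_eq_zero.mp ((pow_eq_zero_iff two_ne_zero).mp hx)
  · have hy := (Finset.sum_eq_zero_iff_of_nonneg fun y _ => by positivity).mp e3 y (Finset.mem_univ y)
    exact norm_eq_zero.mp ((pow_eq_zero_iff two_ne_zero).mp hy)

/-- **(1.72)** «Thus if for some A we have Δ_aA = 0, then ΔA − ∂P∂*A = 0, QA = 0» (`a > 0`).
[cite: Balaban1984PropagatorsI, (1.72) p.30] -/
theorem eq172 (ha : 0 < a) {A : Tor (fine n M) × Fin d → ℂ} (hA : DeltaA n M a *ᵥ A = 0) :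
    Lap n M *ᵥ A - GradOp (fine n M) (n : ℂ) *ᵥ (PcT n M (n : ℂ) *ᵥ ((GradOp (fine n M) (n : ℂ))ᴴ *ᵥ A)) = 0
      ∧ QvOp n M *ᵥ A = 0 := by
  have hQ := (consequences_of_DeltaA_eq_zero n M a ha hA).2.2
  refine ⟨?_, hQ⟩
  have h := hA
  rw [DeltaA_mulVec, hQ, Matrix.mulVec_zero, smul_zero, add_zero] at h
  exact h

/-! ## §3 The printed zero-mode argument -/

/-- «From the first equation we get A = ∂Δ⁻²Q′*(Q′Δ⁻²Q′*)⁻¹ω + A₀, where A₀ is a constant vector function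
and ω is a function on unit lattice T₁^{(k)}» — with `ω = Q′Δ⁻¹∂*A` and `A₀` the componentwise mean of `A`:
from `∂A = 0` (torus Poincaré lemma: `A = ∂Δ⁻¹∂*A + A₀`) and `R∂*A = 0` (`∂*A = P∂*A = Δ⁻¹Q′*(Q′Δ⁻²Q′*)⁻¹ω`,
(1.70)). [cite: Balaban1984PropagatorsI, p.30 after (1.72)] -/
theorem eq_of_first_equation {A : Tor (fine n M) × Fin d → ℂ}
    (hF : ∀ μ ν x, Fs (fine n M) (n : ℂ) A μ ν x = 0) (hR : RdivS n M A = 0) :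
    A = GradOp (fine n M) (n : ℂ) *ᵥ (LapSinv (fine n M) (n : ℂ) *ᵥ (LapSinv (fine n M) (n : ℂ) *ᵥ
          (QsAdj n M *ᵥ (Einv n M *ᵥ (QsOp n M *ᵥ (LapSinv (fine n M) (n : ℂ) *ᵥ
            ((GradOp (fine n M) (n : ℂ))ᴴ *ᵥ A)))))))
        + B0 (fine n M) A := by
  have hnc : (n : ℂ) ≠ 0 := by exact_mod_cast NeZero.ne n
  -- `R∂*A = 0`, i.e. `∂*A = P∂*A = Δ⁻¹Q′*(Q′Δ⁻²Q′*)⁻¹Q′Δ⁻¹∂*A`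
  have hs : (GradOp (fine n M) (n : ℂ))ᴴ *ᵥ A
      = LapSinv (fine n M) (n : ℂ) *ᵥ (QsAdj n M *ᵥ (Einv n M *ᵥ (QsOp n M *ᵥ
          (LapSinv (fine n M) (n : ℂ) *ᵥ ((GradOp (fine n M) (n : ℂ))ᴴ *ᵥ A))))) := by
    have h := hR
    rw [RdivS, Matrix.sub_mulVec, Matrix.one_mulVec, sub_eq_zero] at h
    rw [QsAdj_Einv, ← PcT_mulVec]
    exact h
  -- the Poincaré lemma, then substitute
  have hP := eq_grad_add_const_of_Fs_eq_zero (fine n M) hnc hF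
  conv_lhs => rw [hP]
  conv_lhs => rw [hs]

/-- «… and ω is a function on unit lattice T₁^{(k)} orthogonal to constant functions»: `Σ_y ω(y) = 0` for
`ω = Q′Δ⁻¹∂*A`. [cite: Balaban1984PropagatorsI, p.30 after (1.72)] -/
theorem sum_omega (A : Tor (fine n M) × Fin d → ℂ) :
    ∑ y, (QsOp n M *ᵥ (LapSinv (fine n M) (n : ℂ) *ᵥ ((GradOp (fine n M) (n : ℂ))ᴴ *ᵥ A))) y = 0 :=
  sum_QsOp_LapSinv n M (n : ℂ) _

/-- **«Using (1.55) we have QA = ∂₁Q′Δ⁻²Q′*(Q′Δ⁻²Q′*)⁻¹ω + A₀ = ∂₁ω + A₀»** for `ω ⊥ 1` and a constant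
vector function `A₀` with components `c` (`Q∂ = ∂₁Q′` (1.55), `Q′Δ⁻²Q′*(Q′Δ⁻²Q′*)⁻¹ = I` on `1^⊥`, `QA₀ = A₀`).
[cite: Balaban1984PropagatorsI, p.30 after (1.72), (1.55) p.27] -/
theorem QvOp_first_equation (ω : Tor M → ℂ) (hω : ∑ y, ω y = 0) (c : Fin d → ℂ) :
    QvOp n M *ᵥ (GradOp (fine n M) (n : ℂ) *ᵥ (LapSinv (fine n M) (n : ℂ) *ᵥ (LapSinv (fine n M) (n : ℂ) *ᵥ
        (QsAdj n M *ᵥ (Einv n M *ᵥ ω)))) + constV (fine n M) c)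
      = GradOp M 1 *ᵥ ω + constV M c := by
  rw [Matrix.mulVec_add, QvOp_GradOp_mulVec, QsOp_LapSinv2_QsAdj_Einv n M ω hω, QvOp_constV]

/-- **«hence ∂₁*∂₁ω = 0»**: from `∂₁ω + A₀ = 0` (`∂₁*A₀ = 0`, `∂₁*∂₁ = Δ₀`).
[cite: Balaban1984PropagatorsI, p.30 after (1.72)] -/
theorem LapS_omega_eq_zero {ω : Tor M → ℂ} {c : Fin d → ℂ} (h : GradOp M 1 *ᵥ ω + constV M c = 0) :
    LapS M 1 *ᵥ ω = 0 := by
  have h' := congrArg (fun V => (GradOp M 1)ᴴ *ᵥ V) h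
  simp only [Matrix.mulVec_add, Matrix.mulVec_zero] at h'
  rw [divS_GradOp_mulVec M 1, divS_constV, add_zero] at h'
  exact h'

/-- **«and this implies ω = 0»** (`ω ⊥ 1`: `ω = Δ₀⁻¹Δ₀ω`). [cite: Balaban1984PropagatorsI, p.30 after (1.72)] -/
theorem omega_eq_zero {ω : Tor M → ℂ} (hω : ∑ y, ω y = 0) (hΔ : LapS M 1 *ᵥ ω = 0) : ω = 0 := by
  rw [← LapSinv_LapS_of_orth M one_ne_zero ω hω, hΔ, Matrix.mulVec_zero]

/-- **«The above equation implies A₀ = 0»**: with `ω = 0`, `∂₁ω + A₀ = 0` forces the constant to vanish.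
[cite: Balaban1984PropagatorsI, p.30 after (1.72)] -/
theorem const_eq_zero {ω : Tor M → ℂ} {c : Fin d → ℂ} (h : GradOp M 1 *ᵥ ω + constV M c = 0) (hω0 : ω = 0) :
    c = 0 := by
  subst hω0
  rw [Matrix.mulVec_zero, zero_add] at h
  funext μ
  have := congrFun h ((0 : Tor M), μ)
  exact this

/-- **«so A = 0»: `Δ_aA = 0 ⇒ A = 0`** (`a > 0`), by the printed road: (1.72) ⇒ `∂A = 0`, `R∂*A = 0`, `QA = 0`
⇒ `A = ∂Δ⁻²Q′*(Q′Δ⁻²Q′*)⁻¹ω + A₀` ⇒ `QA = ∂₁ω + A₀ = 0` ⇒ `∂₁*∂₁ω = 0` ⇒ `ω = 0` ⇒ `A₀ = 0` ⇒ `A = 0`.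
[cite: Balaban1984PropagatorsI, p.30 after (1.72)] -/
theorem eq_zero_of_DeltaA_mulVec_eq_zero (ha : 0 < a) {A : Tor (fine n M) × Fin d → ℂ}
    (hA : DeltaA n M a *ᵥ A = 0) : A = 0 := by
  obtain ⟨hF, hR, hQ⟩ := consequences_of_DeltaA_eq_zero n M a ha hA
  have hA1 := eq_of_first_equation n M hF hR
  set ω : Tor M → ℂ := QsOp n M *ᵥ (LapSinv (fine n M) (n : ℂ) *ᵥ ((GradOp (fine n M) (n : ℂ))ᴴ *ᵥ A))
    with hωdef
  set c : Fin d → ℂ := fun μ => ((Fintype.card (Tor (fine n M)) : ℂ))⁻¹ * ∑ y, A (y, μ) with hcdef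
  have hω : ∑ y, ω y = 0 := sum_omega n M A
  have hB0 : B0 (fine n M) A = constV (fine n M) c := rfl
  -- «Using (1.55) we have QA = ∂₁ω + A₀ = 0»
  have hQ' : GradOp M 1 *ᵥ ω + constV M c = 0 := by
    rw [← QvOp_first_equation n M ω hω c, ← hB0, ← hA1]
    exact hQ
  -- «hence ∂₁*∂₁ω = 0, and this implies ω = 0. The above equation implies A₀ = 0»
  have hω0 : ω = 0 := omega_eq_zero M hω (LapS_omega_eq_zero M hQ')
  have hc0 : c = 0 := const_eq_zero M hQ' hω0
  -- «so A = 0»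
  have hconst : constV (fine n M) c = 0 := by
    rw [hc0]
    rfl
  rw [hA1, hB0, hconst, add_zero, hω0, Matrix.mulVec_zero, Matrix.mulVec_zero, Matrix.mulVec_zero,
    Matrix.mulVec_zero, Matrix.mulVec_zero]

/-! ## §4 «It is an invertible operator and the equation (1.73) has a unique solution» -/

/-- `Δ_a` has trivial kernel, hence `A ↦ Δ_aA` is injective (`a > 0`).
[cite: Balaban1984PropagatorsI, p.30 («It is an invertible operator»)] -/
theorem DeltaA_mulVec_injective (ha : 0 < a) : Function.Injective (DeltaA n M a).mulVec := by
  intro A A' h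
  have h0 : DeltaA n M a *ᵥ (A - A') = 0 := by
    rw [Matrix.mulVec_sub]
    exact sub_eq_zero.mpr h
  exact sub_eq_zero.mp (eq_zero_of_DeltaA_mulVec_eq_zero n M a ha h0)

/- «It is an invertible operator» — OBTAINED from the printed kernel argument (the decl of record is
`B5DeltaA169.isUnit_DeltaA`, via the (1.83) fibres). -/
example (ha : 0 < a) : IsUnit (DeltaA n M a) :=
  (Matrix.mulVec_injective_iff_isUnit).mp (DeltaA_mulVec_injective n M a ha)

/- «the equation (1.73) has a unique solution for the arbitrary vector function J» — from invertibility
(decl of record `B5DeltaA169.existsUnique_solution`). -/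
example (ha : 0 < a) (J : Tor (fine n M) × Fin d → ℂ) :
    ∃! A : Tor (fine n M) × Fin d → ℂ, DeltaA n M a *ᵥ A = J := by
  have hU : IsUnit (DeltaA n M a) :=
    (Matrix.mulVec_injective_iff_isUnit).mp (DeltaA_mulVec_injective n M a ha)
  have hdet := (Matrix.isUnit_iff_isUnit_det _).mp hU
  refine ⟨(DeltaA n M a)⁻¹ *ᵥ J, ?_, fun A hA => ?_⟩
  · show DeltaA n M a *ᵥ ((DeltaA n M a)⁻¹ *ᵥ J) = J
    rw [Matrix.mulVec_mulVec, Matrix.mul_nonsing_inv _ hdet, Matrix.one_mulVec]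
  · exact DeltaA_mulVec_injective n M a ha (by
      show DeltaA n M a *ᵥ A = DeltaA n M a *ᵥ ((DeltaA n M a)⁻¹ *ᵥ J)
      rw [hA, Matrix.mulVec_mulVec, Matrix.mul_nonsing_inv _ hdet, Matrix.one_mulVec])

end Main

end

end Literature.MathematicalPhysics.QuantumFieldTheory.Balaban1983to89.B5Eq172Torus
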